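import Mathlib
import Literature.NumberTheory.EllipticCurves.Smith2016.CongruentNumberGenusDeterminantRowSevenSelmer
import Literature.NumberTheory.EllipticCurves.Smith2016.CongruentNumberGenusDecompositionPointed

/-!
# Smith 2016, Theorem 2.2 row 7(b) for every `k`: `Σ₂'(n) − Σ₁(n) = det M_{7b}`, and `Σ₂'(n) ≢ Σ₁(n)` `⟹ #Sel₂(E⁽ⁿ⁾) = 8` (`n ≡ 7 (8)`)

A. Smith, *The congruent numbers have positive natural density*, arXiv:1603.08479 [Smith2016CongruentDensity],
Table 2 row 7(b) (source `cnc.tex` l. 117–124): for `n ≡ 7 (mod 8)`,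
`ℒ_{7b}(n) = Σ_{d₀d₁ | n, d₀ ≡ 5 (8), d₁ ≡ 3 (8)} g(d₀)g(d₁)ℒ(n/d₀d₁)`,
`M_{7b} = [[A + Aᵀ, Aᵀ, y + z, y],[A, D_z, 0, 0],[(y+z)ᵀ, 0, 0, 0],[yᵀ, 0, 0, 0]]`; Thm. 2.2: `ℒ_{7b}(n) = det M_{7b}`.
By Thm. 2.1 of the source (= [TianYuanZhang2017] Thm. 1.2 as printed), for `n ≡ 7 (8)`: `Σ₁(n) = ℒ_{7a}(n)` and
`Σ₂'(n) = ℒ_{7a}(n) + ℒ_{7b}(n)` (main block `d₀ ≡ 7` with all other blocks `≡ 1`, or main block `d₀ ≡ 5` with one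
companion `d₁ ≡ 3 (8)`: the tree's brackets `B₇`, `B₅ᵢ` of `TianYuanZhang2017.W2`).

What is proved (every number of prime factors; no named fact):
* `genusSum₂'_eq_genusSum₁_add_bFiveI_of_seven`, `natCast_bFiveI_eq_sum_powerset_seven` — the genus side:
  `Σ₂'(n) = Σ₁(n) + B₅ᵢ(n)` and `B₅ᵢ(n) ≡ Σ_{B : d_B ≡ 3 (8)} g(d_B) Σ_{B′ : d_{B′} ≡ 5 (8)} g(d_{B′}) ℒ(d_{[k]∖B∖B′})`;
* `genusSum₂'_eq_genusSum₁_add_det_sevenB` — **row 7(b)**: for `n = p₁⋯p_k ≡ 7 (mod 8)`,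
  `Σ₂'(n) ≡ Σ₁(n) + det M_{7b} (mod 2)` with `M_{7b}` the iterated bordered block matrix
  `[[[[M₁, (t+z;0)],[(t+z;0)ᵀ, 0]], ((t;0);0)],[((t;0);0)ᵀ, 0]]`, `t = ((−1/pᵢ)₊)`, `z = ((2/pᵢ)₊)`;
* `card_selmerGroup_two_eq_eight_of_genusSum_ne_seven` — **for `n ≡ 7 (mod 8)`: `Σ₂'(n) ≢ Σ₁(n) (mod 2)`
  `⟹ #Sel⁽²⁾(E⁽ⁿ⁾/ℚ) = 8`** (Smith's Prop. 3.2 for `x = 7b`; `CongruentNumberGenusDeterminantRowSevenSelmer`).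
-/

namespace Literature.NumberTheory.EllipticCurves.Smith2016

open _root_.Matrix Finset Literature.LinearAlgebra.Matrix Literature.Combinatorics.Enumerative
open Literature.NumberTheory.EllipticCurves.HeathBrown1994
open Literature.NumberTheory.EllipticCurves.TianYuanZhang2017
open Literature.NumberTheory.EllipticCurves.TianYuanZhang2017.W2
open Literature.NumberTheory.EllipticCurves.MonskySelmerParity

variable {k : ℕ} (p : Fin k → ℕ)

section GenusSide

open scoped Classical in
/-- **`Σ₂'(n) = Σ₁(n) + B₅ᵢ(n)` for `n ≡ 7 (mod 8)`** (`B₅ = B₆ = 0`, `Σ₁ = B₇`).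
[cite: TianYuanZhang2017, Thm. 1.2 as printed (n ≡ 7 (8)) and proof of Thm. 3.5 (2) (p0020 L123–L165)] -/
theorem genusSum₂'_eq_genusSum₁_add_bFiveI_of_seven {n : ℕ} (h7 : n % 8 = 7) :
    genusSum₂' n gK = genusSum₁ n gK + bFiveI n := by
  rw [genusSum₂'_eq_brackets, bFivePlain_eq_zero_of_seven h7, bSix_eq_zero_of_odd (Nat.odd_iff.mpr (by omega)),
    genusSum₁_eq_bSeven h7, zero_add, add_zero, add_comm]

open scoped Classical in
/-- The row-7(b) pointed weight: for `n ≡ 7 (8)` and `d₀ ∈ D ∈ decompositions n`, `d₀` is a main block of type `5ᵢ`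
iff `d₀ ≡ 5 (8)` with exactly one companion `e ≡ 3 (8)` and all others `≡ 1 (8)`; the bracket summand is then
`ν₅(d₀) · Σ_{e ≠ d₀} ν₃(e) ∏_{d ≠ d₀,e} [d ≡ 1 (8)] g(d)`.
[cite: TianYuanZhang2017, Thm. 1.2 and proof of Thm. 3.5 (2) (p0020 L123–L165: main block d₀ ≡ 5 with a block ≡ 3, n ≡ 7)] -/
theorem natCast_bFiveI_summand_eq_seven {n : ℕ} (h7 : n % 8 = 7) {D : Finset ℕ} (hD : D ∈ decompositions n)
    {d₀ : ℕ} (hd₀ : d₀ ∈ D) :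
    ((if MainBlock D d₀ ∧ QFiveI D d₀ then ∏ d ∈ D, gK d else 0 : ℕ) : ZMod 2) =
      (if d₀ % 8 = 5 then ((gK d₀ : ℕ) : ZMod 2) else 0) *
        ∑ e ∈ D.erase d₀, (if e % 8 = 3 then ((gK e : ℕ) : ZMod 2) else 0) *
          ∏ d ∈ (D.erase d₀).erase e, (if d % 8 = 1 then ((gK d : ℕ) : ZMod 2) else 0) := by
  by_cases hP : MainBlock D d₀ ∧ QFiveI D d₀
  · have hM := hP.1
    have hQ5 : d₀ % 8 = 5 := hP.2.1
    rw [if_pos hP, if_pos hQ5, Nat.cast_prod, ← mul_prod_erase D (fun d => ((gK d : ℕ) : ZMod 2)) hd₀]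
    congr 1
    rcases mainBlock_cases hD hd₀ hM with ⟨h, -⟩ | ⟨e, heD, hne, he23, hne8, hrest⟩
    · omega
    · have he3 : e % 8 = 3 := by
        rw [hQ5] at hne8; rcases he23 with h | h <;> rw [h] at hne8 <;> omega
      have he' : e ∈ D.erase d₀ := mem_erase.mpr ⟨hne, heD⟩
      rw [← mul_prod_erase (D.erase d₀) (fun d => ((gK d : ℕ) : ZMod 2)) he',
        sum_eq_single_of_mem e he' (fun e' he'' hne' => by
          have h1 := hrest e' (mem_of_mem_erase he'') (ne_of_mem_erase he'') hne'
          rw [if_neg (by omega), zero_mul]), if_pos he3]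
      congr 1
      refine prod_congr rfl fun d hd => ?_
      rw [if_pos (hrest d (mem_of_mem_erase (mem_of_mem_erase hd)) (ne_of_mem_erase (mem_of_mem_erase hd))
        (ne_of_mem_erase hd))]
  · rw [if_neg hP, Nat.cast_zero]
    by_cases h5 : d₀ % 8 = 5
    · rw [if_pos h5]
      symm
      rw [mul_eq_zero]
      right
      refine sum_eq_zero fun e he => ?_
      by_cases he3 : e % 8 = 3
      · rw [if_pos he3]
        by_contra hne
        have hall : ∀ d ∈ (D.erase d₀).erase e, d % 8 = 1 := by
          intro d hd
          by_contra hd1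
          apply hne
          rw [prod_eq_zero hd (by rw [if_neg hd1]), mul_zero]
        apply hP
        refine ⟨⟨Or.inl h5, fun d hd hdd => ?_, ?_⟩, h5, e, mem_of_mem_erase he, he3⟩
        · by_cases hde : d = e
          · rw [hde]; exact Or.inr (Or.inr he3)
          · exact Or.inl (hall d (mem_erase.mpr ⟨hde, mem_erase.mpr ⟨hdd, hd⟩⟩))
        · rw [Finset.card_le_one]
          intro a ha b hb
          rw [mem_filter] at ha hb
          have hae : a = e := by
            by_contra h; exact ha.2 (hall a (mem_erase.mpr ⟨h, ha.1⟩))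
          have hbe : b = e := by
            by_contra h; exact hb.2 (hall b (mem_erase.mpr ⟨h, hb.1⟩))
          rw [hae, hbe]
      · rw [if_neg he3, zero_mul]
    · rw [if_neg h5, zero_mul]

open scoped Classical in
/-- **`B₅ᵢ` as a two-pointed product weight** for `n ≡ 7 (mod 8)`:
`B₅ᵢ(n) ≡ Σ_D Σ_{d₀ ∈ D} Σ_{e ∈ D∖d₀} ν₅(d₀) · ν₃(e) · ∏_{d ∈ D∖{d₀,e}} [d ≡ 1 (8)] g(d) (mod 2)`.
[cite: TianYuanZhang2017, Thm. 1.2 and proof of Thm. 3.5 (2) (p0020 L123–L165)] [cite: Smith2016CongruentDensity, Table 2 row 7(b) (ℒ_{7b})] -/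
theorem natCast_bFiveI_eq_sum_twoPointed_seven {n : ℕ} (h7 : n % 8 = 7) :
    ((bFiveI n : ℕ) : ZMod 2) = ∑ D ∈ decompositions n, ∑ d₀ ∈ D, ∑ e ∈ D.erase d₀,
      (if d₀ % 8 = 5 then ((gK d₀ : ℕ) : ZMod 2) else 0) *
        ((if e % 8 = 3 then ((gK e : ℕ) : ZMod 2) else 0) *
          ∏ d ∈ (D.erase d₀).erase e, (if d % 8 = 1 then ((gK d : ℕ) : ZMod 2) else 0)) := by
  rw [bFiveI, coef, Nat.cast_sum]
  refine sum_congr rfl fun D hD => ?_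
  rw [sum_filter, Nat.cast_sum]
  refine sum_congr rfl fun d₀ hd₀ => ?_
  rw [← mul_sum, ← natCast_bFiveI_summand_eq_seven h7 hD hd₀]
  by_cases hM : MainBlock D d₀
  · rw [if_pos hM]
    by_cases hQ : QFiveI D d₀
    · rw [if_pos hQ, if_pos ⟨hM, hQ⟩]
    · rw [if_neg hQ, if_neg (fun h => hQ h.2)]
  · rw [if_neg hM, if_neg (fun h => hM h.1)]

/-- **`B₅ᵢ` over index blocks** for `n = p₁⋯p_k ≡ 7 (mod 8)`:
`B₅ᵢ(n) ≡ Σ_{B ⊆ [k], d_B ≡ 3 (8)} g(d_B) · Σ_{B′ ⊆ [k]∖B, d_{B′} ≡ 5 (8)} g(d_{B′}) · ℒ(d_{[k]∖B∖B′}) (mod 2)` — Smith's `ℒ_{7b}(n)`.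
[cite: Smith2016CongruentDensity, Thm. 2.2 / Table 2 row 7(b) (source cnc.tex l. 117–124)] [cite: TianYuanZhang2017, Thm. 1.2 (n ≡ 7 (8))] -/
theorem natCast_bFiveI_eq_sum_powerset_seven (hp : ∀ i, (p i).Prime) (hinj : Function.Injective p)
    (h8 : (∏ i, p i) % 8 = 7) :
    ((bFiveI (∏ i, p i) : ℕ) : ZMod 2) =
      ∑ B ∈ (univ : Finset (Fin k)).powerset,
        (if (∏ i ∈ B, p i) % 8 = 3 then ((gK (∏ i ∈ B, p i) : ℕ) : ZMod 2) else 0) *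
        ∑ B' ∈ (univ \ B).powerset,
          (if (∏ i ∈ B', p i) % 8 = 5 then ((gK (∏ i ∈ B', p i) : ℕ) : ZMod 2) else 0) *
          ∑ D ∈ decompositions (∏ i ∈ (univ \ B) \ B', p i), ∏ d ∈ D,
            (if d % 8 = 1 then ((gK d : ℕ) : ZMod 2) else 0) := by
  rw [natCast_bFiveI_eq_sum_twoPointed_seven h8,
    show (∏ i, p i) = ∏ i ∈ (univ : Finset (Fin k)), p i from rfl,
    sum_decompositions_twoPointed_prod_eq p hp hinj _ _ _ univ]
  rw [sum_filter_of_ne (fun B _ hB => by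
    by_contra h
    rw [not_nonempty_iff_eq_empty] at h
    rw [h, prod_empty, if_neg (by norm_num), zero_mul] at hB
    exact hB rfl)]
  rw [sum_congr rfl fun B _ => by rw [sum_filter_of_ne (fun B' _ hB' => by
    by_contra h
    rw [not_nonempty_iff_eq_empty] at h
    rw [h, prod_empty, if_neg (by norm_num), zero_mul] at hB'
    exact hB' rfl)]]
  simp_rw [mul_sum]
  rw [sum_powerset_sum_powerset_sdiff_comm]
  refine sum_congr rfl fun S _ => sum_congr rfl fun C _ => ?_
  rw [sdiff_sdiff_comm]
  ring

end GenusSide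

section RowSevenB

/-- **Smith 2016, Theorem 2.2 row 7(b) — for every `k`**: for `n = p₁⋯p_k ≡ 7 (mod 8)` a product of distinct odd
primes, `Σ₂'(n) ≡ Σ₁(n) + det M_{7b} (mod 2)`, i.e. `ℒ_{7b}(n) = Σ₂'(n) − Σ₁(n) = det M_{7b}`, where
`M_{7b} = [[A + Aᵀ, Aᵀ, t + z, t],[A, D_z, 0, 0],[(t+z)ᵀ, 0, 0, 0],[tᵀ, 0, 0, 0]]` (as an iterated bordered block matrix).
[cite: Smith2016CongruentDensity, Thm. 2.2 row 7(b) / Table 2 (source cnc.tex l. 117–124) and §2.2 (cnc2.tex l. 36–42)] [cite: TianYuanZhang2017, Thm. 1.2 as printed (n ≡ 7 (8): the sums Σ₁ and Σ₂')] -/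
theorem genusSum₂'_eq_genusSum₁_add_det_sevenB (hp : ∀ i, (p i).Prime) (hodd : ∀ i, Odd (p i))
    (hinj : Function.Injective p) (h8 : (∏ i, p i) % 8 = 7) :
    ((genusSum₂' (∏ i, p i) (fun d => genusClassNumber (GenusField d)) : ℕ) : ZMod 2) =
      ((genusSum₁ (∏ i, p i) (fun d => genusClassNumber (GenusField d)) : ℕ) : ZMod 2) +
      (fromBlocks (fromBlocks (fromBlocks (legendreMatrix p + (legendreMatrix p)ᵀ) (legendreMatrix p)ᵀ (legendreMatrix p)
            (legendreDiagonal p 2))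
          (replicateCol Unit (Sum.elim (fun i => addLegendreSym (-1) (p i) + addLegendreSym 2 (p i)) (0 : Fin k → ZMod 2)))
          (replicateRow Unit (Sum.elim (fun i => addLegendreSym (-1) (p i) + addLegendreSym 2 (p i)) (0 : Fin k → ZMod 2))) 0)
        (replicateCol Unit (Sum.elim (Sum.elim (fun i => addLegendreSym (-1) (p i)) (0 : Fin k → ZMod 2)) 0))
        (replicateRow Unit (Sum.elim (Sum.elim (fun i => addLegendreSym (-1) (p i)) (0 : Fin k → ZMod 2)) 0)) 0).det := by
  rw [show (fun d => genusClassNumber (GenusField d)) = gK from rfl, genusSum₂'_eq_genusSum₁_add_bFiveI_of_seven h8,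
    Nat.cast_add, natCast_bFiveI_eq_sum_powerset_seven p hp hinj h8, det_sevenB_eq_sum_genusWeight p hp hodd hinj]
  rfl

end RowSevenB

section SelmerEight

/-- **For `n = p₁⋯p_k ≡ 7 (mod 8)`: `Σ₂'(n) ≢ Σ₁(n) (mod 2)` `⟹ #Sel⁽²⁾(E⁽ⁿ⁾/ℚ) = 8`** (`ℒ_{7b}(n) = det M_{7b}` is odd,
Smith's Prop. 3.2 for `x = 7b`). [cite: Smith2016CongruentDensity, Prop. 3.2 (chunk p0011 L58–L66) with Thm. 2.2 row 7(b)] [cite: TianYuanZhang2017, Thm. 1.2 as printed (n ≡ 7 (8))] -/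
theorem card_selmerGroup_two_eq_eight_of_genusSum_ne_seven (hp : ∀ i, (p i).Prime) (hodd : ∀ i, Odd (p i))
    (hinj : Function.Injective p) (h8 : (∏ i, p i) % 8 = 7)
    (hne : ((genusSum₂' (∏ i, p i) (fun d => genusClassNumber (GenusField d)) : ℕ) : ZMod 2) ≠
      ((genusSum₁ (∏ i, p i) (fun d => genusClassNumber (GenusField d)) : ℕ) : ZMod 2)) :
    Nat.card ((congruentNumberCurve (∏ i, p i)).selmerGroup 2) = 8 := by
  refine card_selmerGroup_two_eq_eight_of_det_border_border_ne_zero_seven p hp hodd hinj h8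
    (Sum.elim (fun i => addLegendreSym (-1) (p i) + addLegendreSym 2 (p i)) (0 : Fin k → ZMod 2))
    (Sum.elim (fun i => addLegendreSym (-1) (p i)) (0 : Fin k → ZMod 2)) (fun h0 => hne ?_)
  rw [genusSum₂'_eq_genusSum₁_add_det_sevenB p hp hodd hinj h8, h0, add_zero]

end SelmerEight

end Literature.NumberTheory.EllipticCurves.Smith2016
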